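import Mathlib.RingTheory.Norm.Basic
import Mathlib.RingTheory.TensorProduct.Free
import Mathlib.RingTheory.TensorProduct.Maps
import Mathlib.LinearAlgebra.Matrix.Block
import HarnessLib

/-!
# Full sets of sections of a finite locally free scheme — Katz–Mazur's norm form (pure commutative algebra)

Topic `AlgebraicGeometry/GroupSchemes`; namespace `Literature.AlgebraicGeometry.GroupSchemes` (plus ONE deliberate
dot-notation extension `AlgHom.pointBaseChange` of Mathlib's `AlgHom`, see its docstring).  DEFINITIONS WITH BODIES and
fully proved structure theorems only: **no named fact, no `sorry`, no instance, no notation**.  Cell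
`pub/hodgecm-mathlib`, programme P6 («MOD»), generic organ L5.1 of MOD-PLAN v0.9 §5; the two definitions are the day-1 kit
desk `F0/P6-kit/DrinfeldLevelStructure.desk.A-p07g17.lean` §1 (A-p07 (g17)) — `AlgHom.pointBaseChange` verbatim,
`IsFullSetOfSections` with a freeness guard added (see its docstring) — the theorems are new.

## Mathematics

Let `Z = Spec A → S = Spec R` be finite locally free of rank `N` and `P₁, …, P_N ∈ Z(S)` (ring maps `A → R`).  Katz and
Mazur [KatzMazur1985, §1.8 (1.8.2)] call the `Pᵢ` a **full set of sections** of `Z/S` when for every `S`-scheme `T` and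
every `g ∈ Γ(Z_T, 𝒪)` one has `Norm_{Z_T/T}(g) = ∏ᵢ g(Pᵢ)`; it suffices to test affine `T = Spec R′`.  Harris–Taylor
[HarrisTaylorAMS2001, §II.2 p. 73] define a **Drinfeld `℘^m`-structure** on a Barsotti–Tate `𝒪_K`-module `H/S` as an
`𝒪_K`-linear `α : (℘^{-m}/𝒪_K)^h → H[℘^m](S)` whose values form a full set of sections, and record
[HarrisTaylorAMS2001, Lemma II.2.1 (1)] that the notion is stable under base change `T → S` and [loc. cit. (3), proof
p. 76] that on `𝒪_S[T]/(T^N)` the `N`-fold zero section is a full set of sections because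
«the norm down to `𝒪_S` of `f = f₀ + f₁T + ⋯` is `f₀^N = f(0)^N`».

## Contents (all `R′` range over the commutative rings in the universe of `R` for which `R′ ⊗_R A` is free, so that
Mathlib's `Algebra.norm` — the determinant of left multiplication — is the honest norm; for `A` free over `R` that is
every `R′`)

* §1 `AlgHom.pointBaseChange P R′ : R′ ⊗[R] A →ₐ[R′] R′` — the `R′`-point `P_{R′}` deduced from an `R`-point
  `P : A →ₐ[R] R`; `pointBaseChange_tmul`; TRANSITIVITY `pointBaseChange_cancelBaseChange` (`(P_{R′})_{R″} = P_{R″}` along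
  Mathlib's `Algebra.TensorProduct.cancelBaseChange : R″ ⊗[R′] (R′ ⊗[R] A) ≃ₐ[R″] R″ ⊗[R] A`); NATURALITY
  `map_pointBaseChange` in `R′`; transport `pointBaseChange_congr_symm` along `A ≃ₐ[R] B`.
* §2 `IsFullSetOfSections P` (the predicate, for a family `P : J → (A →ₐ[R] R)`, `J` finite; the kit desk's text with
  a freeness guard on `R′ ⊗_R A` added, see its docstring) and its formal calculus: `norm_eq` (the case `R′ = R`:
  `Norm_{A/R}(a) = ∏ᵢ Pᵢ(a)`), `norm_eq_zero` (a function vanishing at one of the sections has norm `0`),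
  **`IsFullSetOfSections.baseChange`** ([HarrisTaylorAMS2001, Lemma II.2.1 (1)] at the level of the
  finite flat scheme), `comp_equiv` (reindexing), `of_algEquiv` (transport along `Spec B ≅ Spec A` over `S`).
* §3 two norm computations over an arbitrary base (private helper `leftMulMatrix_eq_sum_repr_mul_repr`; the norm
  for a basis of ORTHOGONAL IDEMPOTENTS `norm_eq_prod_repr_of_basis_mul_basis`; the norm for a TRUNCATED POWER BASIS
  `1, ε, …, ε^{N-1}`, `ε^N = 0`: **`norm_eq_pow_of_basis_eq_pow`**, `Norm(g) = P(g)^N` — the displayed sentence of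
  [HarrisTaylorAMS2001, p. 76]).
* §4 the two basic EXAMPLES: **`isFullSetOfSections_piEval`** — the `|J|` coordinate evaluations of the split algebra
  `A = J → R` (the trivial étale cover `∐_J S → S`; constant∕étale level structures) and
  **`isFullSetOfSections_const_of_basis_eq_pow`** — the `N`-FOLD REPEATED zero section of `Spec R[ε]/(ε^N)` (the
  infinitesimal group schemes `α_{p^n}`, `μ_{p^n}` in characteristic `p`; [HarrisTaylorAMS2001, Lemma II.2.1 (3)]):
  multiplicities are allowed, which is the point of Drinfeld level structures.

What is deliberately NOT here: the characteristic-polynomial form of the condition and its equivalence with the norm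
form [KatzMazur1985, §1.8], the Cartier-divisor form inside a smooth curve [KatzMazur1985, Thm. 1.10.1], closed
subschemes defined by a full set of sections [KatzMazur1985, Cor. 1.10.3], representability of Drinfeld level structures
[HarrisTaylorAMS2001, Lemma II.2.1 (6)], group schemes (the desk's §2–§3 `AffineGroupChart.IsDrinfeld`,
`DrinfeldLevelDatum` belong to the P6c line).  HC_CM is proved only modulo the printed citations until rung 0 closes; this
file changes no count.

## References
* [KatzMazur1985] N. M. Katz, B. Mazur, *Arithmetic Moduli of Elliptic Curves*, Ann. of Math. Stud. 108 (1985), §1.8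
  («full sets of sections», (1.8.2)), §1.9–§1.10.
* [HarrisTaylorAMS2001] M. Harris, R. Taylor, *The Geometry and Cohomology of Some Simple Shimura Varieties*, Ann. of
  Math. Stud. 151 (2001), §II.2 p. 73 (Drinfeld `℘_K^m`-structures), Lemma II.2.1 (1), (3) and its proof pp. 75–76.
-/

set_option autoImplicit false

noncomputable section

open scoped TensorProduct

universe u

/-! ## §1 The base change of a point -/

/-- **The base change `P_{R′}` of an `R`-point.**  For an `R`-algebra `A`, an `R`-point `P : A →ₐ[R] R` of
`Spec A → Spec R` and an `R`-algebra `R′`, the `R′`-point `R′ ⊗_R A → R′`, `r ⊗ a ↦ r · P(a)` of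
`Spec (R′ ⊗_R A) → Spec R′` (Mathlib `Algebra.TensorProduct.lift` of `id_{R′}` and `R → R′ ∘ P`).  A deliberate
dot-notation extension of Mathlib's `AlgHom` namespace (P6 day-1 kit desk L5.1, verbatim).
[cite: KatzMazur1985, §1.8 (1.8.2)] -/
def AlgHom.pointBaseChange {R A : Type u} [CommRing R] [CommRing A] [Algebra R A] (P : A →ₐ[R] R)
    (R' : Type u) [CommRing R'] [Algebra R R'] : R' ⊗[R] A →ₐ[R'] R' :=
  Algebra.TensorProduct.lift (AlgHom.id R' R') ((Algebra.ofId R R').comp P) fun _ _ => Commute.all _ _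

namespace AlgHom

variable {R A : Type u} [CommRing R] [CommRing A] [Algebra R A]

/-- `P_{R′}(r ⊗ a) = r · P(a)`. [cite: KatzMazur1985, §1.8 (1.8.2)] -/
@[simp]
theorem pointBaseChange_tmul (P : A →ₐ[R] R) (R' : Type u) [CommRing R'] [Algebra R R'] (r : R') (a : A) :
    P.pointBaseChange R' (r ⊗ₜ[R] a) = r * algebraMap R R' (P a) := by
  simp [pointBaseChange]

/-- **Transitivity of base change of points**: along Mathlib's canonical isomorphism
`R″ ⊗_{R′} (R′ ⊗_R A) ≅ R″ ⊗_R A`, the point `(P_{R′})_{R″}` is `P_{R″}` (`R → R′ → R″` a tower).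
[cite: KatzMazur1985, §1.8 (1.8.2)] -/
theorem pointBaseChange_cancelBaseChange (P : A →ₐ[R] R) (R' : Type u) [CommRing R'] [Algebra R R']
    (R'' : Type u) [CommRing R''] [Algebra R R''] [Algebra R' R''] [IsScalarTower R R' R'']
    (x : R'' ⊗[R'] (R' ⊗[R] A)) :
    P.pointBaseChange R'' (Algebra.TensorProduct.cancelBaseChange R R' R'' R'' A x) =
      (P.pointBaseChange R').pointBaseChange R'' x := by
  induction x using TensorProduct.induction_on with
  | zero => simp
  | add x y hx hy => simp [hx, hy]
  | tmul r y =>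
    induction y using TensorProduct.induction_on with
    | zero => simp
    | add x y hx hy => simp [TensorProduct.tmul_add, hx, hy]
    | tmul r' a =>
      simp only [Algebra.TensorProduct.cancelBaseChange_tmul, pointBaseChange_tmul, map_mul,
        Algebra.smul_def, IsScalarTower.algebraMap_apply R R' R'']
      ring

/-- **Naturality of `P_{R′}` in `R′`**: for an `R`-algebra map `φ : R′ → R″`,
`φ (P_{R′} x) = P_{R″} ((φ ⊗ id) x)`. [cite: KatzMazur1985, §1.8 (1.8.2)] -/
theorem map_pointBaseChange (P : A →ₐ[R] R) {R' R'' : Type u} [CommRing R'] [Algebra R R'] [CommRing R'']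
    [Algebra R R''] (φ : R' →ₐ[R] R'') (x : R' ⊗[R] A) :
    φ (P.pointBaseChange R' x) = P.pointBaseChange R'' (Algebra.TensorProduct.map φ (AlgHom.id R A) x) := by
  induction x using TensorProduct.induction_on with
  | zero => simp
  | add x y hx hy => simp [hx, hy]
  | tmul r a => simp [AlgHom.commutes]

/-- **Transport along an isomorphism of `R`-algebras**: for `e : A ≃ₐ[R] B` and the transported point `P ∘ e⁻¹` of
`Spec B`, `(P ∘ e⁻¹)_{R′} = P_{R′} ∘ (id ⊗ e)⁻¹`. [cite: KatzMazur1985, §1.8 (1.8.2)] -/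
theorem pointBaseChange_congr_symm (P : A →ₐ[R] R) {B : Type u} [CommRing B] [Algebra R B] (e : A ≃ₐ[R] B)
    (R' : Type u) [CommRing R'] [Algebra R R'] (y : R' ⊗[R] B) :
    (P.comp (e.symm : B →ₐ[R] A)).pointBaseChange R' y =
      P.pointBaseChange R' ((Algebra.TensorProduct.congr (AlgEquiv.refl : R' ≃ₐ[R'] R') e).symm y) := by
  induction y using TensorProduct.induction_on with
  | zero => simp
  | add x y hx hy => simp [hx, hy]
  | tmul r b => simp [Algebra.TensorProduct.congr_symm_apply, Algebra.TensorProduct.map_tmul]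

end AlgHom

namespace Literature.AlgebraicGeometry.GroupSchemes

/-! ## §2 Full sets of sections: the predicate and its formal calculus -/

section Defs

variable {R A : Type u} [CommRing R] [CommRing A] [Algebra R A]

/-- **FULL SET OF SECTIONS (Katz–Mazur's norm form).**  A family `P : J → (A →ₐ[R] R)` of `R`-points of the
`R`-algebra `A` (sections of `Spec A → Spec R`) is a *full set of sections* when, after every base change `R → R′`
(commutative rings in the universe of `R`) UNDER WHICH `R′ ⊗_R A` IS A FREE `R′`-MODULE, the norm of every
`g ∈ R′ ⊗_R A` is the product of its values at the points: `Norm_{(R′ ⊗ A)/R′}(g) = ∏ᵢ P_{i,R′}(g)`.  The freeness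
guard makes Mathlib's `Algebra.norm` (the determinant of left multiplication, which takes a junk value without a finite
basis) the honest norm in every instance used; for `A` finite FREE over `R` the guard is automatic (every base change
is free), and for `A` finite locally free the guarded `R′` include all local ones — Katz–Mazur state the condition over
every `S`-scheme `T`, which amounts to the same since norms commute with base change and equality of functions on `T`
is Zariski-local.  Intended for `A` finite locally free of rank `|J|`; the rank hypothesis is a hypothesis of USE, not
part of the predicate (P6 day-1 kit desk L5.1, with the freeness guard added). [cite: KatzMazur1985, §1.8 (1.8.2)] -/
def IsFullSetOfSections {J : Type} [Fintype J] (P : J → (A →ₐ[R] R)) : Prop :=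
  ∀ (R' : Type u) [CommRing R'] [Algebra R R'] [Module.Free R' (R' ⊗[R] A)] (g : R' ⊗[R] A),
    Algebra.norm R' g = ∏ i, (P i).pointBaseChange R' g

variable {J : Type} [Fintype J] {P : J → (A →ₐ[R] R)}

/-- The case `R′ = R` of the definition, read on `A` itself (`A` free over `R`): `Norm_{A/R}(a) = ∏ᵢ Pᵢ(a)`.
[cite: KatzMazur1985, §1.8 (1.8.2)] -/
theorem IsFullSetOfSections.norm_eq [Module.Free R A] (hP : IsFullSetOfSections P) (a : A) :
    Algebra.norm R a = ∏ i, P i a := by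
  have h := hP R ((Algebra.TensorProduct.lid R A).symm a)
  rw [Algebra.norm_eq_of_algEquiv] at h
  rw [h]
  refine Finset.prod_congr rfl fun i _ => ?_
  simp [Algebra.TensorProduct.lid_symm_apply]

/-- A function vanishing at one of the sections of a full set has norm zero (after any base change).
[cite: KatzMazur1985, §1.8 (1.8.2)] -/
theorem IsFullSetOfSections.norm_eq_zero (hP : IsFullSetOfSections P) (R' : Type u) [CommRing R'] [Algebra R R']
    [Module.Free R' (R' ⊗[R] A)] (g : R' ⊗[R] A) (i : J) (hi : (P i).pointBaseChange R' g = 0) :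
    Algebra.norm R' g = 0 := by
  rw [hP R' g]
  exact Finset.prod_eq_zero (Finset.mem_univ i) hi

/-- **Full sets of sections are stable under base change** (Harris–Taylor's Lemma II.2.1 (1) at the level of the finite
flat scheme): if `(Pᵢ)` is a full set of sections of `Spec A → Spec R`, then `(P_{i,R′})` is a full set of sections of
`Spec (R′ ⊗_R A) → Spec R′`.  (A further base change `R′ → R″` of `R′ ⊗_R A` is the base change `R → R″` of `A`
along Mathlib's `cancelBaseChange`, under which freeness, norms and the points correspond; Harris–Taylor derive the
Barsotti–Tate case from [KatzMazur1985, Prop. 1.9.1].) [cite: HarrisTaylorAMS2001, Lemma II.2.1 (1)] -/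
theorem IsFullSetOfSections.baseChange (hP : IsFullSetOfSections P) (R' : Type u) [CommRing R'] [Algebra R R'] :
    IsFullSetOfSections (R := R') (A := R' ⊗[R] A) fun i => (P i).pointBaseChange R' := by
  intro R'' _ _ _ g
  letI : Algebra R R'' := ((algebraMap R' R'').comp (algebraMap R R')).toAlgebra
  haveI : IsScalarTower R R' R'' := IsScalarTower.of_algebraMap_eq fun _ => rfl
  haveI : Module.Free R'' (R'' ⊗[R] A) :=
    Module.Free.of_equiv (Algebra.TensorProduct.cancelBaseChange R R' R'' R'' A).toLinearEquiv
  have h := hP R'' (Algebra.TensorProduct.cancelBaseChange R R' R'' R'' A g)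
  rw [Algebra.norm_eq_of_algEquiv] at h
  rw [h]
  exact Finset.prod_congr rfl fun i _ => (P i).pointBaseChange_cancelBaseChange R' R'' g

/-- Reindexing a full set of sections along a bijection `J′ ≃ J` gives a full set of sections (the notion depends only on
the unordered family with multiplicities). [cite: KatzMazur1985, §1.8 (1.8.2)] -/
theorem IsFullSetOfSections.comp_equiv (hP : IsFullSetOfSections P) {J' : Type} [Fintype J'] (e : J' ≃ J) :
    IsFullSetOfSections (P ∘ e) := by
  intro R' _ _ _ g
  rw [hP R' g]
  exact (Fintype.prod_equiv e (fun i' => (P (e i')).pointBaseChange R' g) _ fun _ => rfl).symm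

/-- **Transport along an `R`-isomorphism**: if `(Pᵢ)` is a full set of sections of `Spec A → Spec R` and
`e : A ≃ₐ[R] B`, then `(Pᵢ ∘ e⁻¹)` is a full set of sections of `Spec B → Spec R`.
[cite: KatzMazur1985, §1.8 (1.8.2)] -/
theorem IsFullSetOfSections.of_algEquiv (hP : IsFullSetOfSections P) {B : Type u} [CommRing B] [Algebra R B]
    (e : A ≃ₐ[R] B) : IsFullSetOfSections fun i => (P i).comp (e.symm : B →ₐ[R] A) := by
  intro R' _ _ _ g
  haveI : Module.Free R' (R' ⊗[R] A) :=
    Module.Free.of_equiv (Algebra.TensorProduct.congr (AlgEquiv.refl : R' ≃ₐ[R'] R') e).symm.toLinearEquiv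
  have h := hP R' ((Algebra.TensorProduct.congr (AlgEquiv.refl : R' ≃ₐ[R'] R') e).symm g)
  rw [Algebra.norm_eq_of_algEquiv] at h
  rw [h]
  exact Finset.prod_congr rfl fun i _ => ((P i).pointBaseChange_congr_symm e R' g).symm

end Defs

/-! ## §3 Norm computations in a basis -/

section Matrix

variable {R S : Type*} [CommRing R] [CommRing S] [Algebra R S] {ι : Type*} [Fintype ι] [DecidableEq ι]

/-- The matrix of left multiplication by `g` in a basis `b`, expanded along `g = ∑ₖ cₖ bₖ`:
`(g·)_{ij} = ∑ₖ cₖ · [bₖ bⱼ : bᵢ]` (private linear-algebra helper). [folklore] -/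
private theorem leftMulMatrix_eq_sum_repr_mul_repr (b : Module.Basis ι R S) (g : S) (i j : ι) :
    Algebra.leftMulMatrix b g i j = ∑ k, b.repr g k * b.repr (b k * b j) i := by
  rw [Algebra.leftMulMatrix_eq_repr_mul]
  conv_lhs => rw [← b.sum_repr g, Finset.sum_mul]
  simp_rw [smul_mul_assoc, map_sum, map_smul, Finsupp.coe_finsetSum, Finset.sum_apply, Finsupp.smul_apply,
    smul_eq_mul]

/-- **Norm in a basis of orthogonal idempotents.**  If `bₖ bⱼ = δ_{kj} bⱼ` for all `k, j` (e.g. the coordinate basis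
of the split algebra `J → R`), then left multiplication by `g = ∑ cⱼ bⱼ` is the diagonal matrix `diag(cⱼ)` and
`Norm_{S/R}(g) = ∏ⱼ cⱼ` — the computation behind «the canonical sections of the trivial cover `∐_N S → S` form a
full set of sections». [cite: KatzMazur1985, §1.8 (1.8.2)] -/
theorem norm_eq_prod_repr_of_basis_mul_basis (b : Module.Basis ι R S)
    (hb : ∀ k j, b k * b j = if k = j then b j else 0) (g : S) : Algebra.norm R g = ∏ j, b.repr g j := by
  rw [Algebra.norm_eq_matrix_det b]
  have hM : Algebra.leftMulMatrix b g = Matrix.diagonal fun j => b.repr g j := by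
    ext i j
    rw [leftMulMatrix_eq_sum_repr_mul_repr, Matrix.diagonal_apply,
      Finset.sum_eq_single j (fun k _ hk => by rw [hb, if_neg hk, map_zero, Finsupp.zero_apply, mul_zero])
        (fun h => (h (Finset.mem_univ j)).elim)]
    rw [hb, if_pos rfl, b.repr_self, Finsupp.single_apply]
    by_cases hij : i = j
    · subst hij; simp
    · rw [if_neg (Ne.symm hij), if_neg hij, mul_zero]
  rw [hM, Matrix.det_diagonal]

/-- **Norm in a truncated power basis** — the displayed sentence of Harris–Taylor's proof of Lemma II.2.1 (3): if `S`
has an `R`-basis `1, ε, …, ε^{N-1}` with `ε^N = 0` (so `S ≅ R[T]/(T^N)`) and `P : S → R` is the point `ε ↦ 0`, then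
for `g = g₀ + g₁ε + ⋯ + g_{N-1}ε^{N-1}` the matrix of `g·` is lower triangular with diagonal `g₀ = P(g)`, hence
`Norm_{S/R}(g) = g₀^N = P(g)^N`. [cite: HarrisTaylorAMS2001, Lemma II.2.1 (3), proof p. 76] -/
theorem norm_eq_pow_of_basis_eq_pow {N : ℕ} (ε : S) (b : Module.Basis (Fin N) R S)
    (hb : ∀ i, b i = ε ^ (i : ℕ)) (hε : ε ^ N = 0) (P : S →ₐ[R] R) (hP : P ε = 0) (g : S) :
    Algebra.norm R g = (P g) ^ N := by
  -- structure constants of the truncated power basis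
  have hmul : ∀ k j i : Fin N, b.repr (b k * b j) i = if (k : ℕ) + j = i then 1 else 0 := by
    intro k j i
    rw [hb k, hb j, ← pow_add]
    by_cases h : (k : ℕ) + j < N
    · have hkj : ε ^ ((k : ℕ) + j) = b ⟨k + j, h⟩ := by rw [hb]
      rw [hkj, b.repr_self, Finsupp.single_apply]
      simp only [Fin.ext_iff]
    · rw [pow_eq_zero_of_le (not_lt.mp h) hε, map_zero, Finsupp.zero_apply, if_neg]
      intro hk
      exact h (hk ▸ i.isLt)
  have hentry : ∀ i j : Fin N,
      Algebra.leftMulMatrix b g i j = ∑ k, b.repr g k * (if (k : ℕ) + j = i then 1 else 0) := by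
    intro i j
    rw [leftMulMatrix_eq_sum_repr_mul_repr]
    exact Finset.sum_congr rfl fun k _ => by rw [hmul]
  -- lower triangular …
  have htri : (Algebra.leftMulMatrix b g).BlockTriangular OrderDual.toDual := by
    intro i j hij
    have hij' : (i : ℕ) < j := by simpa using hij
    rw [hentry]
    refine Finset.sum_eq_zero fun k _ => ?_
    rw [if_neg, mul_zero]
    omega
  -- … with diagonal `P g`
  have hdiag : ∀ i : Fin N, Algebra.leftMulMatrix b g i i = P g := by
    intro i
    set z : Fin N := ⟨0, Fin.pos i⟩ with hz
    have hzval : ((z : Fin N) : ℕ) = 0 := rfl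
    rw [hentry, Finset.sum_eq_single z (fun k _ hk => ?_) (fun h => (h (Finset.mem_univ z)).elim), if_pos (by omega),
      mul_one]
    · -- `P g = c₀`
      conv_rhs => rw [← b.sum_repr g]
      rw [map_sum, Finset.sum_eq_single z (fun k _ hk => ?_) (fun h => (h (Finset.mem_univ z)).elim)]
      · rw [map_smul, hb, map_pow, hzval, pow_zero, smul_eq_mul, mul_one]
      · have hk0 : (k : ℕ) ≠ 0 := fun h0 => hk (Fin.ext (by rw [h0, hzval]))
        rw [map_smul, hb, map_pow, hP, zero_pow hk0, smul_zero]
    · have hk0 : (k : ℕ) ≠ 0 := fun h0 => hk (Fin.ext (by rw [h0, hzval]))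
      rw [if_neg (by omega), mul_zero]
  rw [Algebra.norm_eq_matrix_det b, Matrix.det_of_lowerTriangular _ htri, Finset.prod_congr rfl fun i _ => hdiag i,
    Finset.prod_const, Finset.card_univ, Fintype.card_fin]

end Matrix

/-! ## §4 The two basic examples: the split cover and the thickened point -/

section Examples

variable {R : Type u} [CommRing R]

/-- **The split (constant) case.**  For the split finite étale algebra `A = (J → R)` (`Spec A = ∐_J Spec R`), the `|J|`
coordinate evaluations `ev_j : A → R` form a full set of sections: after base change, `R′ ⊗_R (J → R)` has the
orthogonal-idempotent basis `1 ⊗ e_j`, left multiplication by `g = ∑ c_j (1 ⊗ e_j)` is `diag(c_j)`, and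
`ev_{j,R′}(g) = c_j`.  (Constant∕étale level structures are full sets of sections.) [cite: KatzMazur1985, §1.8 (1.8.2)] -/
theorem isFullSetOfSections_piEval (J : Type) [Fintype J] [DecidableEq J] :
    IsFullSetOfSections (R := R) (A := J → R) fun j => Pi.evalAlgHom R (fun _ : J => R) j := by
  intro R' _ _ _ g
  let b' := Algebra.TensorProduct.basis R' (Pi.basisFun R J)
  have hb' : ∀ k j, b' k * b' j = if k = j then b' j else 0 := by
    intro k j
    simp only [b', Algebra.TensorProduct.basis_apply, Algebra.TensorProduct.tmul_mul_tmul, one_mul, Pi.basisFun_apply]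
    split_ifs with h
    · subst h
      rw [← Pi.single_mul, mul_one]
    · have hkj : (Pi.single k 1 : J → R) * Pi.single j 1 = 0 := by
        ext x
        rcases eq_or_ne x k with rfl | hx
        · simp [h]
        · simp [hx]
      rw [hkj, TensorProduct.tmul_zero]
  rw [norm_eq_prod_repr_of_basis_mul_basis b' hb' g]
  refine Finset.prod_congr rfl fun j _ => ?_
  -- `ev_{j,R′}(g) = c_j`
  conv_rhs => rw [← b'.sum_repr g]
  rw [map_sum, Finset.sum_eq_single j (fun k _ hk => ?_) (fun h => (h (Finset.mem_univ j)).elim)]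
  · simp [b', Algebra.TensorProduct.basis_apply]
  · simp [b', Algebra.TensorProduct.basis_apply, Ne.symm hk]

variable {A : Type u} [CommRing A] [Algebra R A]

/-- **The thickened point (multiplicities allowed).**  If `A` has an `R`-basis `1, ε, …, ε^{N-1}` with `ε^N = 0`
(`Spec A = Spec R[ε]/(ε^N)`, e.g. the infinitesimal group schemes `α_{p^n}`, `μ_{p^n}` in characteristic `p`) and `P`
is the point `ε ↦ 0`, then the CONSTANT family `(P, …, P)` (`N` copies) is a full set of sections: the hypotheses are
stable under base change (`1 ⊗ ε^i = (1 ⊗ ε)^i` is an `R′`-basis of `R′ ⊗ A`) and `Norm(g) = P(g)^N`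
(`norm_eq_pow_of_basis_eq_pow`) — Harris–Taylor's verification that the trivial homomorphism is a Drinfeld structure on
`𝒪_S[T]/(T^{p^{fhm}})`. [cite: HarrisTaylorAMS2001, Lemma II.2.1 (3), proof p. 76] -/
theorem isFullSetOfSections_const_of_basis_eq_pow {N : ℕ} (ε : A) (b : Module.Basis (Fin N) R A)
    (hb : ∀ i, b i = ε ^ (i : ℕ)) (hε : ε ^ N = 0) (P : A →ₐ[R] R) (hP : P ε = 0) :
    IsFullSetOfSections fun _ : Fin N => P := by
  intro R' _ _ _ g
  have h := norm_eq_pow_of_basis_eq_pow (R := R') (S := R' ⊗[R] A) ((1 : R') ⊗ₜ[R] ε)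
    (Algebra.TensorProduct.basis R' b)
    (fun i => by rw [Algebra.TensorProduct.basis_apply, hb, Algebra.TensorProduct.tmul_pow, one_pow])
    (by rw [Algebra.TensorProduct.tmul_pow, one_pow, hε, TensorProduct.tmul_zero])
    (P.pointBaseChange R') (by rw [AlgHom.pointBaseChange_tmul, hP, map_zero, mul_zero]) g
  rw [h, Finset.prod_const, Finset.card_univ, Fintype.card_fin]

end Examples

end Literature.AlgebraicGeometry.GroupSchemes

end
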